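import Summits.Ventures.PercRepro.C026AcyclicBridges

/-!
# Attaching trees or hubs at the marks preserves the D-free inequality (p6, gen 11)

mine-3's THEOREM X (INBOX 4853): attaching a hub `v` joined to `a`, `b`, `c` only is exactly monotone for
the `(★)`-slack, so `(★)` on `G` gives `(★)` on `G + v` — the `(★)`-class is closed under hub attachment
at the marks (the `ab`-hub and a pendant edge at a mark included).  In the tree `(★)` is `DFreeIneq`, and
`G + v` is a 3-terminal gluing (`IsGluing`) of `G` with a star at `v`, which is ACYCLIC (no parallel
edges) and in any case a HUB-PAIR multigraph (`v` has no non-mark neighbour); so the inequality form of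
Theorem X is a corollary of the composition theorem `dFreeIneq_of_gluing` (C026GluingCount) with
THEOREM F `Acyclic.dFreeIneq` (C026AcyclicPhi) or p5's `dFreeIneq_of_hubPair`, and it holds for ANY
acyclic or hub-pair bridge attached at the marks:

* `dFreeIneq_of_gluing_acyclic` / `dFreeIneq_of_gluing_acyclicOrHubPair` — a gluing whose `true` part
  is acyclic (or hub-pair) inherits `DFreeIneq` from its `false` part (any marks);
  `dFreeIneq_of_gluingN_acyclic` — the `n`-colour form (one colour class D-free, every other one acyclic);
* `c026_of_gluing_acyclic_of_dFree_minors` / `c026_of_gluing_acyclicOrHubPair_of_dFree_minors` — the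
  every-`p` forms: if every marked minor of the `false` part is D-free, C-026 holds at every `p`;
* `IsMultiHubAt` — the edges of colour `true` are exactly the edges at a non-mark `v`, each joining `v`
  to a mark (parallel edges allowed); `IsMultiHubAt.isGluing`, `IsMultiHubAt.isHubPairGraph_part`;
  **`dFreeIneq_of_multiHubAt`** (THEOREM X, inequality form) and `c026_of_multiHubAt_of_dFree_minors`;
* `IsHubAt` — the simple star (no two edges at `v` to the same vertex: the `abc`-hub, the `ab`-hub, a
  pendant edge at a mark); `IsHubAt.acyclic_part` (axiom-free), `dFreeIneq_of_hubAt`,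
  `c026_of_hubAt_of_dFree_minors` through THEOREM F.

The exact identity of Theorem X (`Δ(G + v) = 2Δ(G) + #none + #Kc + #Lc + #KLc₁ + 2#KLc₂`) is finer than
the inequality proved here; the closure statements are what the composition theorem gives for free.
-/
namespace PercRepro

namespace MultiGraph

variable {V E : Type*} {G : MultiGraph V E}

section GluingAcyclic

variable [Fintype E] [DecidableEq E]

/-- **A gluing with an acyclic part inherits the D-free inequality from the other part** (any marks:
when two marks coincide `bot` is empty). -/
theorem dFreeIneq_of_gluing_acyclic (G : MultiGraph V E) (a b c : V) (side : E → Bool)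
    (hg : G.IsGluing a b c side) (hT : (G.part side true).Acyclic)
    (h₀ : (G.part side false).DFreeIneq a b c) : G.DFreeIneq a b c := by
  by_cases hm : a = b ∨ a = c ∨ b = c
  · exact dFreeIneq_of_marks_eq G hm
  · exact dFreeIneq_of_gluing G a b c (fun h => hm (Or.inl h)) (fun h => hm (Or.inr (Or.inl h)))
      (fun h => hm (Or.inr (Or.inr h))) side hg (hT.dFreeIneq a b c) h₀

/-- **A gluing with an acyclic or hub-pair part inherits the D-free inequality from the other part**
(p5's `dFreeIneq_of_hubPair` on the hub-pair side). -/
theorem dFreeIneq_of_gluing_acyclicOrHubPair (G : MultiGraph V E) (a b c : V) (side : E → Bool)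
    (hg : G.IsGluing a b c side) (hT : (G.part side true).AcyclicOrHubPair a b c)
    (h₀ : (G.part side false).DFreeIneq a b c) : G.DFreeIneq a b c := by
  by_cases hm : a = b ∨ a = c ∨ b = c
  · exact dFreeIneq_of_marks_eq G hm
  · have hab : a ≠ b := fun h => hm (Or.inl h)
    have hac : a ≠ c := fun h => hm (Or.inr (Or.inl h))
    have hbc : b ≠ c := fun h => hm (Or.inr (Or.inr h))
    refine dFreeIneq_of_gluing G a b c hab hac hbc side hg ?_ h₀
    rcases hT with hA | hH
    · exact hA.dFreeIneq a b c
    · exact dFreeIneq_of_hubPair _ hH hab hac hbc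

/-- **The `n`-colour form**: a coloured gluing (`IsGluingN`) whose colour class `i₀` satisfies the D-free
inequality and whose every other colour class is acyclic satisfies the D-free inequality. -/
theorem dFreeIneq_of_gluingN_acyclic {ι : Type*} [Fintype ι] [DecidableEq ι] (G : MultiGraph V E)
    (a b c : V) (col : E → ι) (hg : G.IsGluingN a b c col) (i₀ : ι)
    (h₀ : (G.colPart col i₀).DFreeIneq a b c) (hT : ∀ i, i ≠ i₀ → (G.colPart col i).Acyclic) :
    G.DFreeIneq a b c := by
  by_cases hm : a = b ∨ a = c ∨ b = c
  · exact dFreeIneq_of_marks_eq G hm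
  · refine G.dFreeIneq_of_gluingN a b c (fun h => hm (Or.inl h)) (fun h => hm (Or.inr (Or.inl h)))
      (fun h => hm (Or.inr (Or.inr h))) col hg fun i => ?_
    by_cases hi : i = i₀
    · subst hi; exact h₀
    · exact (hT i hi).dFreeIneq a b c

/-- **The every-`p` form**: if every marked minor of the `false` part is D-free and the `true` part is
acyclic, C-026 holds at every `p ∈ [0,1]^E` on the gluing. -/
theorem c026_of_gluing_acyclic_of_dFree_minors (G : MultiGraph V E) (a b c : V) (side : E → Bool)
    (hg : G.IsGluing a b c side) (hT : (G.part side true).Acyclic)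
    (h₀ : ∀ u₀ v₀ : Config {e // side e = false}, v₀ ≤ u₀ →
      ((G.part side false).minor u₀ v₀).DFreeIneq ((G.part side false).sureClass v₀ a)
        ((G.part side false).sureClass v₀ b) ((G.part side false).sureClass v₀ c))
    (p : E → ℝ) (hp : IsProb p) :
    (G.law3 p a b c 0 + G.law3 p a b c 1) * (G.law3 p a b c 1 + G.law3 p a b c 4) ≤
      G.law3 p a b c 1 + G.law3 p a b c 2 + G.law3 p a b c 3 :=
  c026_of_gluing_of_dFree_minors G a b c side hg (fun u v _ => hT.dFreeIneq_minor a b c u v) h₀ p hp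

/-- **The every-`p` form with a hub-pair part allowed**. -/
theorem c026_of_gluing_acyclicOrHubPair_of_dFree_minors (G : MultiGraph V E) (a b c : V)
    (side : E → Bool) (hg : G.IsGluing a b c side) (hT : (G.part side true).AcyclicOrHubPair a b c)
    (h₀ : ∀ u₀ v₀ : Config {e // side e = false}, v₀ ≤ u₀ →
      ((G.part side false).minor u₀ v₀).DFreeIneq ((G.part side false).sureClass v₀ a)
        ((G.part side false).sureClass v₀ b) ((G.part side false).sureClass v₀ c))
    (p : E → ℝ) (hp : IsProb p) :
    (G.law3 p a b c 0 + G.law3 p a b c 1) * (G.law3 p a b c 1 + G.law3 p a b c 4) ≤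
      G.law3 p a b c 1 + G.law3 p a b c 2 + G.law3 p a b c 3 :=
  c026_of_gluing_of_dFree_minors G a b c side hg (fun u v _ => hT.dFreeIneq_minor u v) h₀ p hp

end GluingAcyclic

section HubAt

/-- **A hub at the marks, parallel edges allowed**: `v` is not a mark; the edges of colour `true` are
exactly the edges at `v`; and every edge at `v` joins `v` to one of the marks — the star at `v` with any
multiplicities (the `abc`-hub of Theorem X, the `ab`-hub, a pendant edge at a mark, doubled edges). -/
structure IsMultiHubAt (G : MultiGraph V E) (v a b c : V) (side : E → Bool) : Prop where
  /-- `v` is not the mark `a`. -/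
  ne_a : v ≠ a
  /-- `v` is not the mark `b`. -/
  ne_b : v ≠ b
  /-- `v` is not the mark `c`. -/
  ne_c : v ≠ c
  /-- The edges of colour `true` are exactly the edges at `v`. -/
  side_iff : ∀ e, side e = true ↔ G.EdgeAt e v
  /-- Every edge at `v` joins `v` to a mark. -/
  toMark : ∀ e, G.EdgeAt e v → G.Joins e v a ∨ G.Joins e v b ∨ G.Joins e v c

/-- **A simple hub at the marks**: a `IsMultiHubAt` in which no two edges at `v` join `v` to the same
vertex (a simple star: the `abc`-hub, the `ab`-hub, a pendant edge at a mark). -/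
structure IsHubAt (G : MultiGraph V E) (v a b c : V) (side : E → Bool) : Prop
    extends G.IsMultiHubAt v a b c side where
  /-- No two edges at `v` join `v` to the same vertex. -/
  unique : ∀ e e' m, G.Joins e v m → G.Joins e' v m → e = e'

variable {v a b c : V} {side : E → Bool}

/-- Every edge at `v` joins `v` to some mark. -/
theorem IsMultiHubAt.exists_mark (h : G.IsMultiHubAt v a b c side) {e : E} (he : G.EdgeAt e v) :
    ∃ m, (m = a ∨ m = b ∨ m = c) ∧ G.Joins e v m := by
  rcases h.toMark e he with hj | hj | hj
  · exact ⟨a, Or.inl rfl, hj⟩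
  · exact ⟨b, Or.inr (Or.inl rfl), hj⟩
  · exact ⟨c, Or.inr (Or.inr rfl), hj⟩

/-- A mark is not `v`. -/
theorem IsMultiHubAt.mark_ne (h : G.IsMultiHubAt v a b c side) {m : V} (hm : m = a ∨ m = b ∨ m = c) :
    m ≠ v := by
  rcases hm with rfl | rfl | rfl
  · exact h.ne_a.symm
  · exact h.ne_b.symm
  · exact h.ne_c.symm

/-- An endpoint of an edge at `v` is `v` or a mark. -/
theorem IsMultiHubAt.endpoint_of_edgeAt (h : G.IsMultiHubAt v a b c side) {e : E} {w : V}
    (hev : G.EdgeAt e v) (hew : G.EdgeAt e w) : w = v ∨ w = a ∨ w = b ∨ w = c := by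
  obtain ⟨m, hm, hj⟩ := h.exists_mark hev
  have hw : w = v ∨ w = m := by
    rcases hj with ⟨h1, h2⟩ | ⟨h1, h2⟩ <;> rcases hew with rfl | rfl
    · exact Or.inl h1
    · exact Or.inr h2
    · exact Or.inr h1
    · exact Or.inl h2
  rcases hw with rfl | rfl
  · exact Or.inl rfl
  · exact Or.inr hm

/-- **A hub at the marks is a 3-terminal gluing**: `v` carries only `true` edges, every other non-mark
only `false` edges. -/
theorem IsMultiHubAt.isGluing (h : G.IsMultiHubAt v a b c side) : G.IsGluing a b c side := by
  intro w hwa hwb hwc e e' he he'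
  by_cases hwv : w = v
  · subst hwv
    rw [(h.side_iff e).2 he, (h.side_iff e').2 he']
  · have key : ∀ f, G.EdgeAt f w → side f = false := by
      intro f hf
      cases hsf : side f with
      | false => rfl
      | true =>
        exfalso
        rcases h.endpoint_of_edgeAt ((h.side_iff f).1 hsf) hf with h1 | h1 | h1 | h1
        · exact hwv h1
        · exact hwa h1
        · exact hwb h1
        · exact hwc h1
    rw [key e he, key e' he']

/-- An edge of the `true` part joining `w` and `x` is an edge at `v`, so `w` and `x` are `v` or marks. -/
theorem IsMultiHubAt.eq_v_of_joins_part (h : G.IsMultiHubAt v a b c side) {e : {e // side e = true}}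
    {w x : V} (hj : (G.part side true).Joins e w x) (hx : x ≠ a ∧ x ≠ b ∧ x ≠ c) : x = v := by
  have hev : G.EdgeAt e.1 v := (h.side_iff e.1).1 e.2
  have hex : G.EdgeAt e.1 x := by
    rcases hj with ⟨_, h2⟩ | ⟨h1, _⟩
    · exact Or.inr h2
    · exact Or.inl h1
  rcases h.endpoint_of_edgeAt hev hex with h1 | h1 | h1 | h1
  · exact h1
  · exact absurd h1 hx.1
  · exact absurd h1 hx.2.1
  · exact absurd h1 hx.2.2

/-- **The star at `v` is a hub-pair multigraph**: a non-mark neighbour of a non-mark along an edge of the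
star is `v` itself. -/
theorem IsMultiHubAt.isHubPairGraph_part (h : G.IsMultiHubAt v a b c side) :
    (G.part side true).IsHubPairGraph a b c := by
  intro w _ _ _ e e' x x' he he' _ _ hx hx'
  rw [h.eq_v_of_joins_part he hx, h.eq_v_of_joins_part he' hx']

/-- **The star at `v` is acyclic when it is simple**: with the edge `e` joining `v` and the mark `m`
closed, no open walk of the `true` part reaches `m` — every edge at `m` in the star joins `v` and `m`,
hence is `e`. -/
theorem IsHubAt.acyclic_part (h : G.IsHubAt v a b c side) : (G.part side true).Acyclic := by
  intro ω e he hconn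
  have hev : G.EdgeAt e.1 v := (h.side_iff e.1).1 e.2
  obtain ⟨m, hm, hj⟩ := h.toIsMultiHubAt.exists_mark hev
  have hmv : m ≠ v := h.toIsMultiHubAt.mark_ne hm
  -- the endpoints of `e` are `v` and `m`
  have hvm : (G.part side true).Conn ω v m := by
    rcases hj with ⟨h1, h2⟩ | ⟨h1, h2⟩
    · simp only [part_fst, part_snd, h1, h2] at hconn
      exact hconn
    · simp only [part_fst, part_snd, h1, h2] at hconn
      exact hconn.symm
  -- every vertex reached from `v` by an open walk is `≠ m`
  refine (Conn.induction (motive := fun w => w ≠ m) hmv.symm ?_ hvm) rfl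
  intro w w' _ hadj _
  rintro rfl
  obtain ⟨f, hf, hfj⟩ := hadj
  have hfv : G.EdgeAt f.1 v := (h.side_iff f.1).1 f.2
  -- `f` joins `v` and `w'`
  have hfm : G.Joins f.1 v w' := by
    simp only [part_fst, part_snd] at hfj
    rcases hfj with ⟨h1, h2⟩ | ⟨h1, h2⟩
    · rcases hfv with h3 | h3
      · exact Or.inl ⟨h3, h2⟩
      · exact absurd (h3.symm.trans h2) hmv.symm
    · rcases hfv with h3 | h3
      · exact absurd (h3.symm.trans h1) hmv.symm
      · exact Or.inr ⟨h1, h3⟩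
  have hfe : f = e := Subtype.ext (h.unique f.1 e.1 w' hfm hj)
  subst hfe
  rw [he] at hf
  exact Bool.false_ne_true hf

variable [Fintype E] [DecidableEq E]

/-- **THEOREM X, inequality form** (mine-3 INBOX 4853), parallel edges allowed: attaching a hub at the
marks preserves the D-free inequality — `(★)` on the `false` part gives `(★)` on `G` (through the
hub-pair class). -/
theorem dFreeIneq_of_multiHubAt (h : G.IsMultiHubAt v a b c side)
    (h₀ : (G.part side false).DFreeIneq a b c) : G.DFreeIneq a b c :=
  dFreeIneq_of_gluing_acyclicOrHubPair G a b c side h.isGluing (Or.inr h.isHubPairGraph_part) h₀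

/-- **Theorem X at every `p`**, parallel edges allowed. -/
theorem c026_of_multiHubAt_of_dFree_minors (h : G.IsMultiHubAt v a b c side)
    (h₀ : ∀ u₀ v₀ : Config {e // side e = false}, v₀ ≤ u₀ →
      ((G.part side false).minor u₀ v₀).DFreeIneq ((G.part side false).sureClass v₀ a)
        ((G.part side false).sureClass v₀ b) ((G.part side false).sureClass v₀ c))
    (p : E → ℝ) (hp : IsProb p) :
    (G.law3 p a b c 0 + G.law3 p a b c 1) * (G.law3 p a b c 1 + G.law3 p a b c 4) ≤
      G.law3 p a b c 1 + G.law3 p a b c 2 + G.law3 p a b c 3 :=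
  c026_of_gluing_acyclicOrHubPair_of_dFree_minors G a b c side h.isGluing
    (Or.inr h.isHubPairGraph_part) h₀ p hp

/-- **THEOREM X, inequality form, for a simple hub through THEOREM F** (the acyclic route). -/
theorem dFreeIneq_of_hubAt (h : G.IsHubAt v a b c side) (h₀ : (G.part side false).DFreeIneq a b c) :
    G.DFreeIneq a b c :=
  dFreeIneq_of_gluing_acyclic G a b c side h.toIsMultiHubAt.isGluing h.acyclic_part h₀

/-- **Theorem X at every `p` for a simple hub** (the acyclic route). -/
theorem c026_of_hubAt_of_dFree_minors (h : G.IsHubAt v a b c side)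
    (h₀ : ∀ u₀ v₀ : Config {e // side e = false}, v₀ ≤ u₀ →
      ((G.part side false).minor u₀ v₀).DFreeIneq ((G.part side false).sureClass v₀ a)
        ((G.part side false).sureClass v₀ b) ((G.part side false).sureClass v₀ c))
    (p : E → ℝ) (hp : IsProb p) :
    (G.law3 p a b c 0 + G.law3 p a b c 1) * (G.law3 p a b c 1 + G.law3 p a b c 4) ≤
      G.law3 p a b c 1 + G.law3 p a b c 2 + G.law3 p a b c 3 :=
  c026_of_gluing_acyclic_of_dFree_minors G a b c side h.toIsMultiHubAt.isGluing h.acyclic_part h₀ p hp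

end HubAt

section Example

variable (G : MultiGraph V E)

/-- `Joins` is decidable when the vertex type has decidable equality. -/
instance decidableJoinsAttach [DecidableEq V] (e : E) (u w : V) : Decidable (G.Joins e u w) := by
  unfold Joins
  infer_instance

/-- `IsMultiHubAt` is decidable on finite types, so concrete hubs are instances by `decide`. -/
instance decidableIsMultiHubAt [Fintype E] [DecidableEq V] (v a b c : V) (side : E → Bool) :
    Decidable (G.IsMultiHubAt v a b c side) :=
  decidable_of_iff (v ≠ a ∧ v ≠ b ∧ v ≠ c ∧ (∀ e, side e = true ↔ G.EdgeAt e v) ∧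
      ∀ e, G.EdgeAt e v → G.Joins e v a ∨ G.Joins e v b ∨ G.Joins e v c)
    ⟨fun ⟨h1, h2, h3, h4, h5⟩ => ⟨h1, h2, h3, h4, h5⟩, fun ⟨h1, h2, h3, h4, h5⟩ => ⟨h1, h2, h3, h4, h5⟩⟩

/-- `IsHubAt` is decidable on finite types. -/
instance decidableIsHubAt [Fintype V] [Fintype E] [DecidableEq V] [DecidableEq E] (v a b c : V)
    (side : E → Bool) : Decidable (G.IsHubAt v a b c side) :=
  decidable_of_iff (G.IsMultiHubAt v a b c side ∧ ∀ e e' m, G.Joins e v m → G.Joins e' v m → e = e')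
    ⟨fun ⟨h1, h2⟩ => ⟨h1, h2⟩, fun ⟨h1, h2⟩ => ⟨h1, h2⟩⟩

/-- The toy hub: marks `0, 1, 2`, the hub `3` joined to each mark (edges `0, 1, 2`), and a body
`0 – 4 – 1` through the non-mark `4` (edges `3, 4`). -/
def toyHub : MultiGraph (Fin 5) (Fin 5) := ⟨![3, 3, 3, 0, 4], ![0, 1, 2, 4, 1]⟩

/-- The colouring of the toy hub: the star at `3` is colour `true`. -/
def toyHubSide : Fin 5 → Bool := ![true, true, true, false, false]

/-- The toy hub is a simple hub at the marks (kernel-decided). -/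
theorem toyHub_isHubAt : toyHub.IsHubAt 3 0 1 2 toyHubSide := by decide

/-- Colouring a body edge with the star's colour breaks the hub property (kernel-decided). -/
theorem toyHub_not_isMultiHubAt : ¬ toyHub.IsMultiHubAt 3 0 1 2 ![true, true, true, true, false] := by
  decide

end Example

end MultiGraph

end PercRepro
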